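import Mathlib
import Literature.NumberTheory.LFunctions.Zhang2022.Section10Sj1321Top
import Literature.NumberTheory.LFunctions.Zhang2022.Section10Range1321MidRel
import HarnessLib

/-!
# Zhang (2022) §10, `Θ₁(𝐚₁₃,𝐚₂₁)`: the top range `P^{0.502} ≤ dr < P^{0.504}` — node
# `Z22:§10.u044` (first line) from Lemma 10.1 and the RELATIVE Lemma 8.4

Topic `Literature/NumberTheory/LFunctions/Zhang2022` (Landau–Siegel audit tree; verdict-neutral).
Y. Zhang, *Discrete mean estimates and the Landau–Siegel zero*, arXiv:2211.02515v1 (2022)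
[Zhang2022LandauSiegel], §10 p. 58, tex L2989–L2993 — **an unrefereed manuscript under
adjudication; nothing here bears on its Theorems 1–2.** ZHANG-L discharge lane (WP10, seat
zl-w10-p4), input of the leaf `Typed.Sec10B.Concl1321` (hypothesis `hC1321` of
`Skeleton.theorem1_of_leaves_v19`).

**`eq1044a_of_rel : Skeleton.Lemma101 c′ → Skeleton.Lemma84Rel c′ → Typed.Sec10B.Eq1044a c′`** —
the tree edge `Sj1321Top.eq1044a_of` (L3, `Section10Sj1321Top`) re-pointed from the printed
(absolute) Lemma 8.4 to its RELATIVE form `Skeleton.Lemma84Rel` (error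
`C𝓛⁻⁶·∏_{q∣dr}(1 − q⁻¹)⁻²`; rows G-adj1-1 / G-d55-3). The proof is the L3 proof verbatim except:
(i) where Lemma 8.4 is used (the good range `P^{0.502} < n < P₁/T` and the boundary point
`n = P^{0.502}`) its error at the divisor pair `(n/r, r)` is `e₂(n/φ(n))²`, uniformly in `r ∣ n`
(`Sj1321Mid.prod_one_sub_inv_inv_sq_eq`), and the per-`n` bound of `Sj1321Mid.norm_sum_divisors_le`
is rescaled by `(n/φ(n))²`; (ii) every window weight is `(n/φ(n))⁹/n` (the crude-bound pieces — the
`T`-window and the point `Tn = P₁`, which do not use Lemma 8.4 — by `(n/φ(n))⁷ ≤ (n/φ(n))⁹`), summed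
by `weight_good_top_le9`, `weight_tail_top_le9`, `Sj1321Mid.weight_point_le9` (constant `e^{1024}`);
(iii) the scalar bookkeeping of `Sj1321Top` (`term_*_le`, `threshold_le`, stated with `e^{256}`) is
reused after factoring `e^{1024} = e^{768}e^{256}`, the threshold being `√𝓛 ≥ e^{1024}K/(επ)`.

## References

* Y. Zhang, arXiv:2211.02515v1 (2022), §10 p. 58; Lemma 10.1 (10.4)–(10.5); §8 Lemma 8.4, (8.10).
  [cite: Zhang2022LandauSiegel, §10 p. 58]
-/

noncomputable section

open Complex Real Finset ComplexConjugate

namespace Literature.NumberTheory.LFunctions.Zhang2022.Sj1321Top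

open Skeleton Typed.Sec10B

variable (c' : ℝ) {D : ℕ}

/-! ## §1. Parameters -/

/-- `P > 0`. [cite: Zhang2022LandauSiegel, §2 (2.6)] -/
private theorem bigP_pos₉ (D : ℕ) : 0 < bigP D := Real.exp_pos _

/-- `P > 1` once `𝓛 > 0`. [cite: Zhang2022LandauSiegel, §2 (2.6)] -/
private theorem one_lt_bigP₉ (hL : 0 < ell D) : 1 < bigP D := by
  rw [bigP]; exact Real.one_lt_exp_iff.2 (pow_pos hL 9)

/-- `log P = 𝓛⁹`. [cite: Zhang2022LandauSiegel, §2 (2.6)] -/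
private theorem log_bigP₉ (D : ℕ) : Real.log (bigP D) = ell D ^ 9 := by rw [bigP, Real.log_exp]

/-- The threshold: `D ≥ ⌈e^{M}⌉ ⇒ 𝓛 ≥ M`. [cite: Zhang2022LandauSiegel, §2 p. 4] -/
private theorem le_ell_of_ceil_exp_le₉ {M : ℝ} (hD : ⌈Real.exp M⌉₊ ≤ D) : M ≤ ell D := by
  have h1 : Real.exp M ≤ (D : ℝ) := le_trans (Nat.le_ceil _) (by exact_mod_cast hD)
  have h2 := Real.log_le_log (Real.exp_pos _) h1
  rwa [Real.log_exp] at h2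

/-- Rescaling of the per-`n` bound of `Sj1321Mid.norm_sum_divisors_le` when Lemma 8.4's error is
`e₂ρ₂` (`ρ₂ = ρ² ≥ 1`, `ρ = n/φ(n)`): `ρ⁷x⁻¹(e₁(e₂ρ₂ + 146Λ′) + Ae₂ρ₂)/L ≤ ρ⁹x⁻¹(e₁(e₂ + 146Λ′) + Ae₂)/L`.
[cite: Zhang2022LandauSiegel, §10 p. 58] -/
private theorem per_n_scale' {ρ ρ2 x e₁ e₂ A Λ' L : ℝ} (hρ2 : ρ ^ 2 = ρ2) (h1 : 1 ≤ ρ2)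
    (hρ : 0 ≤ ρ) (he₁ : 0 ≤ e₁) (hΛ : 0 ≤ Λ') (hx : 0 ≤ x) (hL : 0 < L) :
    ρ ^ 7 / x * ((e₁ * (e₂ * ρ2 + 146 * Λ') + A * (e₂ * ρ2)) / L) ≤
      ρ ^ 9 / x * ((e₁ * (e₂ + 146 * Λ') + A * e₂) / L) := by
  have hρ9 : ρ ^ 9 = ρ ^ 7 * ρ2 := by rw [← hρ2]; ring
  rw [hρ9]
  have hin : e₁ * (e₂ * ρ2 + 146 * Λ') + A * (e₂ * ρ2) ≤ ρ2 * (e₁ * (e₂ + 146 * Λ') + A * e₂) := by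
    nlinarith [mul_nonneg (sub_nonneg.mpr h1) (mul_nonneg he₁ hΛ)]
  have h7 : 0 ≤ ρ ^ 7 / x := by positivity
  calc ρ ^ 7 / x * ((e₁ * (e₂ * ρ2 + 146 * Λ') + A * (e₂ * ρ2)) / L)
      ≤ ρ ^ 7 / x * ((ρ2 * (e₁ * (e₂ + 146 * Λ') + A * e₂)) / L) := by
        gcongr
    _ = ρ ^ 7 * ρ2 / x * ((e₁ * (e₂ + 146 * Λ') + A * e₂) / L) := by ring

/-! ## §2. Window weights `Σ (n/φ(n))⁹/n` over the pieces of the top range -/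

/-- The good piece: `Σ_{⌊P^{0.502}⌋ < n ≤ ⌊P^{0.504}/T⌋} (n/φ(n))⁹/n ≤ e^{1024}(2 + 𝓛⁹)` (`𝓛 ≥ 3`).
[cite: Zhang2022LandauSiegel, §10 p. 58] -/
theorem weight_good_top_le9 (hL : 3 ≤ ell D) :
    ∑ n ∈ Finset.Ioc ⌊bigP D ^ (0.502 : ℝ)⌋₊ ⌊bigP D ^ (0.504 : ℝ) / bigT D⌋₊,
        ((n : ℝ) / Nat.totient n) ^ 9 / n ≤ Real.exp 1024 * (2 + ell D ^ 9) := by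
  have hT1 : 1 ≤ bigT D := Sj1321Mid.one_le_bigT D (by linarith)
  have hT0 : 0 < bigT D := by linarith
  have hP : 0 < bigP D := bigP_pos₉ D
  have hlo2 : (2 : ℝ) ≤ bigP D ^ (0.502 : ℝ) := by
    rw [Sj1321Mid.bigP_rpow_eq]
    have h9 : (3 : ℝ) ^ 9 ≤ ell D ^ 9 := pow_le_pow_left₀ (by norm_num) hL 9
    have : (1 : ℝ) ≤ ell D ^ 9 * 0.502 := by nlinarith
    calc (2 : ℝ) ≤ 1 + 1 := by norm_num
      _ ≤ (ell D ^ 9 * 0.502) + 1 := by linarith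
      _ ≤ Real.exp (ell D ^ 9 * 0.502) := Real.add_one_le_exp _
  have hhi : bigP D ^ (0.502 : ℝ) ≤ bigP D ^ (0.504 : ℝ) / bigT D := by
    rw [le_div_iff₀ hT0, mul_comm]; exact (bigT_mul_rpow_lt hL).le
  have hY : 0 < ⌊bigP D ^ (0.502 : ℝ)⌋₊ := Nat.floor_pos.mpr (by linarith)
  have hYX : ⌊bigP D ^ (0.502 : ℝ)⌋₊ ≤ ⌊bigP D ^ (0.504 : ℝ) / bigT D⌋₊ := Nat.floor_mono hhi
  refine (sum_ratio_pow_div_le 9 hY hYX).trans ?_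
  have hlogY : Real.log (bigP D ^ (0.502 : ℝ) / 2) ≤ Real.log (⌊bigP D ^ (0.502 : ℝ)⌋₊ : ℕ) := by
    refine Real.log_le_log (by linarith) ?_
    have := Nat.sub_one_lt_floor (bigP D ^ (0.502 : ℝ))
    linarith
  have hlogX : Real.log (⌊bigP D ^ (0.504 : ℝ) / bigT D⌋₊ : ℕ) ≤
      Real.log (bigP D ^ (0.504 : ℝ)) := by
    refine Real.log_le_log (by exact_mod_cast lt_of_lt_of_le hY hYX) ?_
    have hP4 : 0 ≤ bigP D ^ (0.504 : ℝ) := Real.rpow_nonneg hP.le _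
    exact (Nat.floor_le (div_nonneg hP4 hT0.le)).trans (div_le_self hP4 hT1)
  rw [Real.log_div (Real.rpow_pos_of_pos hP _).ne' (by norm_num),
    Real.log_rpow hP, log_bigP₉] at hlogY
  rw [Real.log_rpow hP, log_bigP₉] at hlogX
  have hlog2 : Real.log 2 ≤ 1 := by
    have := Real.log_two_lt_d9; linarith
  have h1024 : (2 : ℝ) ^ (9 + 1) = 1024 := by norm_num
  rw [h1024]
  have h9 : 0 ≤ ell D ^ 9 := by positivity
  have hlin : 1 + Real.log (⌊bigP D ^ (0.504 : ℝ) / bigT D⌋₊ : ℕ) -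
      Real.log (⌊bigP D ^ (0.502 : ℝ)⌋₊ : ℕ) ≤ 2 + ell D ^ 9 := by linarith
  exact mul_le_mul_of_nonneg_left hlin (Real.exp_pos _).le

/-- The `T`-window: `Σ_{⌈P₁/T⌉ − 1 < n ≤ ⌈P₁⌉} (n/φ(n))⁹/n ≤ e^{1024}(3 + log T)` (`𝓛 ≥ 3`).
[cite: Zhang2022LandauSiegel, §10 (10.5)] -/
theorem weight_tail_top_le9 (hL : 3 ≤ ell D) :
    ∑ n ∈ Finset.Ioc (⌈bigP D ^ (0.504 : ℝ) / bigT D⌉₊ - 1) ⌈bigP D ^ (0.504 : ℝ)⌉₊,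
        ((n : ℝ) / Nat.totient n) ^ 9 / n ≤ Real.exp 1024 * (3 + Real.log (bigT D)) := by
  have hT1 : 1 ≤ bigT D := Sj1321Mid.one_le_bigT D (by linarith)
  have hT0 : 0 < bigT D := by linarith
  have hP : 0 < bigP D := bigP_pos₉ D
  have hP4 : 0 < bigP D ^ (0.504 : ℝ) := Real.rpow_pos_of_pos hP _
  have hlo2 : (2 : ℝ) ≤ bigP D ^ (0.502 : ℝ) := by
    rw [Sj1321Mid.bigP_rpow_eq]
    have h9 : (3 : ℝ) ^ 9 ≤ ell D ^ 9 := pow_le_pow_left₀ (by norm_num) hL 9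
    have : (1 : ℝ) ≤ ell D ^ 9 * 0.502 := by nlinarith
    calc (2 : ℝ) ≤ 1 + 1 := by norm_num
      _ ≤ (ell D ^ 9 * 0.502) + 1 := by linarith
      _ ≤ Real.exp (ell D ^ 9 * 0.502) := Real.add_one_le_exp _
  have hhi : bigP D ^ (0.502 : ℝ) ≤ bigP D ^ (0.504 : ℝ) / bigT D := by
    rw [le_div_iff₀ hT0, mul_comm]; exact (bigT_mul_rpow_lt hL).le
  set y : ℝ := bigP D ^ (0.504 : ℝ) / bigT D with hy
  have hy2 : (2 : ℝ) ≤ y := hlo2.trans hhi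
  set k : ℕ := ⌈y⌉₊ with hk
  have hk2 : 2 ≤ k := by
    have : (2 : ℝ) ≤ (k : ℝ) := hy2.trans (Nat.le_ceil _)
    exact_mod_cast this
  have hY : 0 < k - 1 := by omega
  have hkR : ((k - 1 : ℕ) : ℝ) = (k : ℝ) - 1 := by
    rw [Nat.cast_sub (by omega)]; norm_num
  have hYR : y / 2 ≤ ((k - 1 : ℕ) : ℝ) := by
    rw [hkR]
    have := Nat.le_ceil y
    rw [← hk] at this
    linarith
  have hYX : k - 1 ≤ ⌈bigP D ^ (0.504 : ℝ)⌉₊ := by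
    have h1 : k ≤ ⌈bigP D ^ (0.504 : ℝ)⌉₊ := Nat.ceil_mono (div_le_self hP4.le hT1)
    omega
  refine (sum_ratio_pow_div_le 9 hY hYX).trans ?_
  have hlogY : Real.log (y / 2) ≤ Real.log ((k - 1 : ℕ) : ℝ) :=
    Real.log_le_log (by linarith) hYR
  have hlogX : Real.log (⌈bigP D ^ (0.504 : ℝ)⌉₊ : ℕ) ≤ Real.log (2 * bigP D ^ (0.504 : ℝ)) := by
    refine Real.log_le_log (by exact_mod_cast lt_of_lt_of_le hY hYX) ?_
    have := Nat.ceil_lt_add_one hP4.le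
    have h1 : (1 : ℝ) ≤ bigP D ^ (0.504 : ℝ) := by
      have := hy2.trans (div_le_self hP4.le hT1); linarith
    linarith
  rw [hy, Real.log_div (div_pos hP4 hT0).ne' (by norm_num), Real.log_div hP4.ne' hT0.ne'] at hlogY
  rw [Real.log_mul (by norm_num) hP4.ne'] at hlogX
  have hlog2 : Real.log 2 ≤ 1 := by
    have := Real.log_two_lt_d9; linarith
  have h1024 : (2 : ℝ) ^ (9 + 1) = 1024 := by norm_num
  rw [h1024]
  have hlin : 1 + Real.log (⌈bigP D ^ (0.504 : ℝ)⌉₊ : ℕ) - Real.log ((k - 1 : ℕ) : ℝ) ≤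
      3 + Real.log (bigT D) := by linarith
  exact mul_le_mul_of_nonneg_left hlin (Real.exp_pos _).le

/-! ## §3. The edge `Lemma101 → Lemma84Rel → Eq1044a` -/

set_option maxHeartbeats 400000 in -- as for the absolute edge `eq1044a_of`: one long assembly
/-- **`Z22:§10.u044` (first line) from Lemma 10.1 and the RELATIVE Lemma 8.4**: the top-range
evaluation `Typed.Sec10B.Eq1044a c′` holds whenever the CLAIM node `Skeleton.Lemma101 c′`
(Lemma 10.1, a tree theorem for `c′ ≥ 0`) and the RELATIVE Lemma 8.4 `Skeleton.Lemma84Rel c′`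
hold — the manuscript's "By Lemma 10.1 and the results in Section 8" for the range
`P^{0.502} ≤ dr < P^{0.504}`, every implicit estimate made explicit: good range
`P^{0.502} < n < P₁/T` ((10.4) × relative Lemma 8.4), boundary point `n = P^{0.502}` ((10.5) ×
relative Lemma 8.4), the point `n = P₁/T` ((10.4) × crude `ξ₀`-tail bound) and the `T`-window
`P₁/T < n < P₁` ((10.5) × crude `ξ₀`-tail bound, `XiZeroMajorant.xiZeroTailMean`); total
`≤ e^{1024}K/(√𝓛·𝓛⁹) ≤ εα` for `√𝓛 ≥ e^{1024}K/(επ)`, `K` explicit in the constants of Lemma 10.1,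
Lemma 8.4 and the `ξ₀`-tail mean. [cite: Zhang2022LandauSiegel, §10 p. 58] -/
theorem eq1044a_of_rel (c' : ℝ) (h101 : Lemma101 c') (h84 : Lemma84Rel c') : Eq1044a c' := by
  obtain ⟨c₁, -, C₁, D₁, h₁⟩ := h101
  obtain ⟨C₂, D₂, h₂⟩ := h84
  obtain ⟨Cξ, Dξ, hξ⟩ := XiZeroMajorant.xiZeroTailMean c'
  intro ε hε
  -- constants
  set Cξp : ℝ := max Cξ 0 with hCξp
  have hCξ0 : 0 ≤ Cξp := le_max_right _ _
  set Kg : ℝ := |C₁| * (|C₂| + 146) + 1000 * |C₂| with hKg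
  set Ke : ℝ := (|C₁| + 1000) * (|C₂| + 146) + 1000 * |C₂| with hKe
  have hKg0 : 0 ≤ Kg := by positivity
  have hKe0 : 0 ≤ Ke := by positivity
  set K : ℝ := 4 * Kg + 8 * Ke + (64 * (|C₁| + 1000) * Cξp + 1168000) +
    (64 * |C₁| * Cξp + 1168000) with hK
  have hK0 : 0 ≤ K := by positivity
  set L₀ : ℝ := max 200 (max (5 * π * |c'| + 1)
    ((Real.exp 256 * (Real.exp 768 * K) / (ε * π)) ^ 2)) with hL₀
  refine ⟨max (max D₁ D₂) (max Dξ ⌈Real.exp L₀⌉₊), fun D _ χ hD hq hp hA j hj => ?_⟩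
  -- thresholds
  have hD₁ : D₁ ≤ D := le_trans (le_trans (le_max_left _ _) (le_max_left _ _)) hD
  have hD₂ : D₂ ≤ D := le_trans (le_trans (le_max_right _ _) (le_max_left _ _)) hD
  have hDξ : Dξ ≤ D := le_trans (le_trans (le_max_left _ _) (le_max_right _ _)) hD
  have hL : L₀ ≤ ell D :=
    le_ell_of_ceil_exp_le₉ (le_trans (le_trans (le_max_right _ _) (le_max_right _ _)) hD)
  have hL200 : 200 ≤ ell D := le_trans (le_max_left _ _) hL
  have hLc : 5 * π * |c'| + 1 ≤ ell D :=
    le_trans (le_trans (le_max_left _ _) (le_max_right _ _)) hL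
  have hLK : (Real.exp 256 * (Real.exp 768 * K) / (ε * π)) ^ 2 ≤ ell D :=
    le_trans (le_trans (le_max_right _ _) (le_max_right _ _)) hL
  have hL3 : 3 ≤ ell D := by linarith
  have hLpos : 0 < ell D := by linarith
  have hL1 : 1 ≤ ell D := by linarith
  -- `s = √𝓛`, `t = log T = 𝓛^{1.1}`
  obtain ⟨ht5, ht4, hLt, htL2, hs2, hs1, hsL⟩ := rpow11_facts hL1
  set s : ℝ := Real.sqrt (ell D) with hs
  set t : ℝ := ell D ^ (1.1 : ℝ) with ht
  have hs0 : 0 < s := by linarith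
  have ht3 : 3 ≤ t := le_trans hL3 hLt
  have ht1 : 1 ≤ t := by linarith
  have hlogT : Real.log (bigT D) = t := by rw [ht, Skeleton.bigT, Real.log_exp]
  have hth : Real.exp 256 * (Real.exp 768 * K) / (ε * π) ≤ s := by
    have h0 : 0 ≤ Real.exp 256 * (Real.exp 768 * K) / (ε * π) := by positivity
    rw [hs, ← Real.sqrt_sq h0]
    exact Real.sqrt_le_sqrt hLK
  -- `α = π𝓛⁻⁹` and the `c′`-condition of the `β`-bounds
  have hα : alpha D = π / ell D ^ 9 := by rw [alpha, bigP, Real.log_exp]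
  have hc : 5 * |c'| * alpha D * ell D ≤ 1 := by
    rw [hα]
    have h8 : ell D ≤ ell D ^ 8 := le_self_pow₀ hL1 (by norm_num)
    have h1 : 5 * |c'| * (π / ell D ^ 9) * ell D = 5 * π * |c'| / ell D ^ 8 := by
      field_simp
    rw [h1, div_le_one (by positivity)]
    nlinarith [Real.pi_pos, abs_nonneg c']
  -- the two lemmas and the tail mean at this `D, χ, j`
  have h₁' := h₁ D χ hD₁ hq hp hA j hj
  have h₂' := h₂ D χ hD₂ hq hp hA j hj 6 (by simp)
  have hξ' : ∀ d r : ℕ, 1 ≤ d → 1 ≤ r → ((d * r : ℕ) : ℝ) < Skeleton.P1 D → ∀ x : ℝ, 1 ≤ x →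
      x ≤ bigT D → ∑ n ∈ Ico 1 ⌈x⌉₊, ‖xiZero c' D j n d r‖ / n ≤
        Cξp * ell D * (1 + Real.log x) ^ 3 := fun d r hd hr hdr x hx1 hx2 => by
    have hlog : 0 ≤ 1 + Real.log x := by
      have := Real.log_nonneg hx1; linarith
    exact (hξ D χ hDξ hq hp j hj d r hd hr hdr x hx1 hx2).trans
      (mul_le_mul_of_nonneg_right (mul_le_mul_of_nonneg_right (le_max_left _ _) hLpos.le)
        (by positivity))
  have hL' : ‖deriv χ.LFunction 1‖ ≤ ell D ^ 3 := Sj1321Mid.norm_derivL_one_le_cube χ hp hL200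
  -- positivity of the basic parameters
  have hP : 0 < bigP D := bigP_pos₉ D
  have hP2 : 0 < bigP D ^ (0.502 : ℝ) := Real.rpow_pos_of_pos hP _
  have hP4 : 0 < bigP D ^ (0.504 : ℝ) := Real.rpow_pos_of_pos hP _
  have hT1 : 1 < bigT D := by
    have h11 : 0 < ell D ^ (1.1 : ℝ) := Real.rpow_pos_of_pos hLpos _
    have := Real.add_one_lt_exp h11.ne'
    rw [Skeleton.bigT]; linarith
  have hT0 : 0 < bigT D := by linarith
  have hlP1 : Real.log (Skeleton.P1 D) = 0.504 * ell D ^ 9 := by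
    rw [Skeleton.P1, Real.log_rpow hP, bigP, Real.log_exp]
  have hlP1pos : 0 < Real.log (Skeleton.P1 D) := by rw [hlP1]; positivity
  have hP1eq : Skeleton.P1 D = bigP D ^ (0.504 : ℝ) := by rw [Skeleton.P1]
  have hTP : bigT D * bigP D ^ (0.502 : ℝ) < bigP D ^ (0.504 : ℝ) := bigT_mul_rpow_lt hL3
  -- the exact layer
  rw [drSum_sub_main_eq_top c' χ hq hL3 j]
  -- abbreviations
  set e₂ : ℝ := |C₂| * (ell D ^ 6)⁻¹ with he₂
  set A : ℝ := 1000 * ell D ^ 3 / ell D ^ 9 with hAdef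
  set Bξ : ℝ := t * (Cξp * ell D * (1 + t) ^ 3) with hBξ
  set Bg : ℝ := (|C₁| * (ell D ^ 15)⁻¹ * (e₂ + 146 * ell D ^ 3) + A * e₂) /
    Real.log (Skeleton.P1 D) with hBg
  set Be : ℝ := ((|C₁| * (ell D ^ 7)⁻¹ + A) * (e₂ + 146 * ell D ^ 3) + A * e₂) /
    Real.log (Skeleton.P1 D) with hBe
  set Bp : ℝ := ((|C₁| * (ell D ^ 7)⁻¹ + A) * Bξ + 146 * A * ell D ^ 3) /
    Real.log (Skeleton.P1 D) with hBp
  set Bt : ℝ := (|C₁| * (ell D ^ 7)⁻¹ * Bξ + 146 * A * ell D ^ 3) /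
    Real.log (Skeleton.P1 D) with hBt
  have he₂0 : 0 ≤ e₂ := by positivity
  have hA0 : 0 ≤ A := by positivity
  have hBξ0 : 0 ≤ Bξ := by positivity
  have hBg0 : 0 ≤ Bg := by positivity
  have hBe0 : 0 ≤ Be := by positivity
  have hBp0 : 0 ≤ Bp := by positivity
  have hBt0 : 0 ≤ Bt := by positivity
  set good : ℕ → Prop := fun n => bigP D ^ (0.502 : ℝ) < (n : ℝ) ∧
    bigT D * (n : ℝ) < bigP D ^ (0.504 : ℝ) with hgood
  set tail : ℕ → Prop := fun n => bigP D ^ (0.504 : ℝ) < bigT D * (n : ℝ) with htail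
  set S := (Finset.Ico 1 (Nsupp D)).filter
      (fun n : ℕ => bigP D ^ (0.502 : ℝ) ≤ (n : ℝ) ∧ (n : ℝ) < bigP D ^ (0.504 : ℝ)) with hSdef
  -- **the per-`n` bound**
  have key : ∀ n ∈ S,
      ‖∑ r ∈ n.divisors, drWeight c' χ j (n / r) r *
          (mSum13 c' χ j n * nSum21 c' χ j (n / r) r -
            (500 * deriv χ.LFunction 1 / Real.log (bigP D) *
                (1 - betaJ c' D j * (Real.log (bigP D ^ (0.504 : ℝ) / n) : ℂ))) *
              (deriv χ.LFunction 1 * PiW χ (n / r) r *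
                frakgW c' D j 6 (Skeleton.P1 D / (n : ℝ)) / (Real.log (Skeleton.P1 D) : ℂ)))‖ ≤
        Bg * (if good n then ((n : ℝ) / Nat.totient n) ^ 9 / n else 0) +
          Bt * (if ¬ good n ∧ tail n then ((n : ℝ) / Nat.totient n) ^ 9 / n else 0) +
          (Be + Bp) * (if ¬ good n ∧ ¬ tail n then ((n : ℝ) / Nat.totient n) ^ 9 / n else 0) := by
    intro n hn
    rw [hSdef, Finset.mem_filter, Finset.mem_Ico] at hn
    obtain ⟨⟨hn1, -⟩, hlo, hhi⟩ := hn
    have hn0 : n ≠ 0 := by omega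
    have hnpos : (0 : ℝ) < n := by exact_mod_cast Nat.pos_of_ne_zero hn0
    obtain ⟨hx1, hx4, hxP, hnT, hlo5⟩ := topRange_facts hL3 hlo hhi
    have hw0 : 0 ≤ ((n : ℝ) / Nat.totient n) ^ 9 / n := by positivity
    -- the relative error of Lemma 8.4 at this `n`: `e₂ρ(n)²`, `ρ(n) = n/φ(n) ≥ 1`
    have hρ1 : 1 ≤ (n : ℝ) / Nat.totient n := one_le_self_div_totient hn0
    have hρ0 : 0 ≤ (n : ℝ) / Nat.totient n := zero_le_one.trans hρ1
    set ρ2 : ℝ := ((n : ℝ) / Nat.totient n) ^ 2 with hρ2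
    have hρ2_1 : 1 ≤ ρ2 := one_le_pow₀ hρ1
    have hρ2_0 : 0 ≤ ρ2 := zero_le_one.trans hρ2_1
    have he₂n0 : 0 ≤ e₂ * ρ2 := mul_nonneg he₂0 hρ2_0
    have h79 : ((n : ℝ) / Nat.totient n) ^ 7 / n ≤ ((n : ℝ) / Nat.totient n) ^ 9 / n :=
      div_le_div_of_nonneg_right (pow_le_pow_right₀ hρ1 (by norm_num)) hnpos.le
    -- sizes of the main values
    have hg : ‖frakgW c' D j 6 (Skeleton.P1 D / (n : ℝ))‖ ≤ 146 :=
      Sj1321Mid.norm_frakgW_six_le c' hLpos hc j hx1 hx4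
    have hm₁ : ‖500 * deriv χ.LFunction 1 / Real.log (bigP D) *
        (1 - betaJ c' D j * (Real.log (bigP D ^ (0.504 : ℝ) / n) : ℂ))‖ ≤ A := by
      refine (norm_mainV1top_le c' χ hLpos hc j hlo hhi.le).trans ?_
      rw [hAdef]
      gcongr
    -- the `n`-sums in Lemma 8.4's shape at `x = P₁/n`, `(d, r) = (n/r, r)`
    have hN : ∀ r ∈ n.divisors, nSum21 c' χ j (n / r) r =
        (1 / (Real.log (Skeleton.P1 D) : ℂ)) *
          ∑ m ∈ Finset.Ico 1 ⌈Skeleton.P1 D / (n : ℝ)⌉₊,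
            χ (m : ZMod D) * xiZero c' D j m (n / r) r / (m : ℂ) *
              (((Skeleton.P1 D / (n : ℝ)) / m : ℝ) : ℂ) ^ (-betaMu D 6) *
              (Real.log ((Skeleton.P1 D / (n : ℝ)) / m) : ℂ) := by
      intro r hr
      have hrn : n / r * r = n := Nat.div_mul_cancel (Nat.dvd_of_mem_divisors hr)
      have hd1 : 1 ≤ n / r := Nat.div_pos (Nat.divisor_le hr) (Nat.pos_of_mem_divisors hr)
      have hr1 : 1 ≤ r := Nat.pos_of_mem_divisors hr
      have hlo' : bigP D ^ (0.5 : ℝ) ≤ ((n / r * r : ℕ) : ℝ) := by rw [hrn]; exact hlo5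
      have h := Sj1321Mid.nSum21_eq c' χ hL3 j hd1 hr1 hlo'
      rw [hrn] at h
      exact h
    -- the `m`-sum is `𝔳₁ⱼ(n)`
    have hMv : mSum13 c' χ j n = frakv1 c' χ j (n : ℝ) := Sj1321Mid.mSum13_eq_frakv1 c' χ hL3 j hlo5
    -- Lemma 8.4 is available when `T < x`, i.e. `T·n < P₁`
    have h2 : bigT D * (n : ℝ) < bigP D ^ (0.504 : ℝ) → ∀ r ∈ n.divisors,
        ‖(∑ m ∈ Finset.Ico 1 ⌈Skeleton.P1 D / (n : ℝ)⌉₊,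
            χ (m : ZMod D) * xiZero c' D j m (n / r) r / (m : ℂ) *
              (((Skeleton.P1 D / (n : ℝ)) / m : ℝ) : ℂ) ^ (-betaMu D 6) *
              (Real.log ((Skeleton.P1 D / (n : ℝ)) / m) : ℂ)) -
          deriv χ.LFunction 1 * PiW χ (n / r) r * frakgW c' D j 6 (Skeleton.P1 D / (n : ℝ))‖
          ≤ e₂ * ρ2 := by
      intro hTn r hr
      have hrn : n / r * r = n := Nat.div_mul_cancel (Nat.dvd_of_mem_divisors hr)
      have hd1 : 1 ≤ n / r := Nat.div_pos (Nat.divisor_le hr) (Nat.pos_of_mem_divisors hr)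
      have hr1 : 1 ≤ r := Nat.pos_of_mem_divisors hr
      have hdrT : ((n / r * r : ℕ) : ℝ) < bigP D / bigT D ^ 2 := by rw [hrn]; exact hnT
      have hTx : bigT D < Skeleton.P1 D / (n : ℝ) := by
        rw [lt_div_iff₀ hnpos, hP1eq]; exact hTn
      have h := h₂' (n / r) r hd1 hr1 hdrT (Skeleton.P1 D / (n : ℝ)) hTx hxP
      refine h.trans ?_
      rw [hrn, Sj1321Mid.prod_one_sub_inv_inv_sq_eq hn0, he₂, hρ2]
      gcongr
      · exact le_abs_self _
    -- the crude bound is available when `x ≤ T`, i.e. `P₁ ≤ T·n`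
    have hS : bigP D ^ (0.504 : ℝ) ≤ bigT D * (n : ℝ) → ∀ r ∈ n.divisors,
        ‖∑ m ∈ Finset.Ico 1 ⌈Skeleton.P1 D / (n : ℝ)⌉₊,
            χ (m : ZMod D) * xiZero c' D j m (n / r) r / (m : ℂ) *
              (((Skeleton.P1 D / (n : ℝ)) / m : ℝ) : ℂ) ^ (-betaMu D 6) *
              (Real.log ((Skeleton.P1 D / (n : ℝ)) / m) : ℂ)‖ ≤ Bξ := by
      intro hTn r hr
      have hrn : n / r * r = n := Nat.div_mul_cancel (Nat.dvd_of_mem_divisors hr)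
      have hd1 : 1 ≤ n / r := Nat.div_pos (Nat.divisor_le hr) (Nat.pos_of_mem_divisors hr)
      have hr1 : 1 ≤ r := Nat.pos_of_mem_divisors hr
      have hxT : Skeleton.P1 D / (n : ℝ) ≤ bigT D := by
        rw [div_le_iff₀ hnpos, hP1eq]; exact hTn
      have hdrP1 : ((n / r * r : ℕ) : ℝ) < Skeleton.P1 D := by rw [hrn, hP1eq]; exact hhi
      have hcr := Sj1321Outer.norm_sum84_le_log_mul c' χ j 6 (n / r) r hx1
      have hξx := hξ' (n / r) r hd1 hr1 hdrP1 _ hx1 hxT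
      have hx0 : 0 < Skeleton.P1 D / (n : ℝ) := by linarith
      have hlogx0 : 0 ≤ Real.log (Skeleton.P1 D / (n : ℝ)) := Real.log_nonneg hx1
      have hlogx : Real.log (Skeleton.P1 D / (n : ℝ)) ≤ t := by
        rw [← hlogT]; exact Real.log_le_log hx0 hxT
      calc _ ≤ Real.log (Skeleton.P1 D / (n : ℝ)) *
            ∑ m ∈ Finset.Ico 1 ⌈Skeleton.P1 D / (n : ℝ)⌉₊, ‖xiZero c' D j m (n / r) r‖ / m := hcr
        _ ≤ t * (Cξp * ell D * (1 + Real.log (Skeleton.P1 D / (n : ℝ))) ^ 3) :=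
            mul_le_mul hlogx hξx (Finset.sum_nonneg fun m _ => by positivity) (by linarith)
        _ ≤ t * (Cξp * ell D * (1 + t) ^ 3) := by gcongr
        _ = Bξ := by rw [hBξ]
    -- case analysis on the position of `n`
    by_cases hgn : good n
    · -- good: (10.4) × Lemma 8.4
      have hng1 : ¬ (¬ good n ∧ tail n) := fun h => h.1 hgn
      have hng2 : ¬ (¬ good n ∧ ¬ tail n) := fun h => h.1 hgn
      rw [if_pos hgn, if_neg hng1, if_neg hng2, mul_zero, mul_zero, add_zero, add_zero]
      have hyT : (n : ℝ) ≤ bigP D ^ (0.504 : ℝ) / bigT D := by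
        rw [le_div_iff₀ hT0, mul_comm]; exact hgn.2.le
      have h1 : ‖mSum13 c' χ j n - 500 * deriv χ.LFunction 1 / Real.log (bigP D) *
          (1 - betaJ c' D j * (Real.log (bigP D ^ (0.504 : ℝ) / n) : ℂ))‖ ≤
          |C₁| * (ell D ^ 15)⁻¹ := by
        rw [hMv]
        refine ((h₁' n).2.2.1 hgn.1 hyT).trans ?_
        exact mul_le_mul_of_nonneg_right (le_abs_self _) (by positivity)
      have := Sj1321Mid.norm_sum_divisors_le c' χ j hn0 (mSum13 c' χ j n) _ _ _ he₂n0
        (by positivity) hlP1pos h1 hm₁ hg hL' hN (h2 hgn.2)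
      refine this.trans ?_
      refine (per_n_scale' hρ2.symm hρ2_1 hρ0 ?_ ?_ hnpos.le hlP1pos).trans (le_of_eq ?_)
      · positivity
      · positivity
      · rw [hBg]; ring
    · by_cases htn : tail n
      · -- `T`-window: (10.5) × crude
        have hc1 : ¬ good n ∧ tail n := ⟨hgn, htn⟩
        have hng2 : ¬ (¬ good n ∧ ¬ tail n) := fun h => h.2 htn
        rw [if_neg hgn, if_pos hc1, if_neg hng2, mul_zero, mul_zero, zero_add, add_zero]
        have hwin : (bigP D ^ (0.5 : ℝ) / bigT D < (n : ℝ) ∧ (n : ℝ) ≤ bigP D ^ (0.5 : ℝ)) ∨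
            (bigP D ^ (0.502 : ℝ) / bigT D < (n : ℝ) ∧ (n : ℝ) ≤ bigP D ^ (0.502 : ℝ)) ∨
            (bigP D ^ (0.504 : ℝ) / bigT D < (n : ℝ) ∧ (n : ℝ) < bigP D ^ (0.504 : ℝ)) := by
          right; right
          refine ⟨?_, hhi⟩
          rw [div_lt_iff₀ hT0, mul_comm]; exact htn
        have hM : ‖mSum13 c' χ j n‖ ≤ |C₁| * (ell D ^ 7)⁻¹ := by
          rw [hMv]
          exact ((h₁' n).2.2.2 hwin).trans
            (mul_le_mul_of_nonneg_right (le_abs_self _) (by positivity))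
        have := norm_sum_divisors_le_crude c' χ j hn0 (mSum13 c' χ j n) _ _ _ hBξ0
          (by positivity) hlP1pos hM hm₁ hg hL' hN (hS htn.le)
        refine this.trans ?_
        refine (mul_le_mul_of_nonneg_right h79 ?_).trans (le_of_eq ?_)
        · exact div_nonneg (by positivity) hlP1pos.le
        · rw [hBt]; ring
      · -- the two possible single points: `n = P^{0.502}` or `T·n = P₁`
        have hc2 : ¬ good n ∧ ¬ tail n := ⟨hgn, htn⟩
        have hng1 : ¬ (¬ good n ∧ tail n) := fun h => htn h.2
        rw [if_neg hgn, if_neg hng1, if_pos hc2, mul_zero, mul_zero, zero_add, zero_add]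
        rw [htail, not_lt] at htn
        rw [hgood, not_and_or] at hgn
        rcases hgn with hb | hb
        · -- `n = P^{0.502}`: (10.5) × Lemma 8.4
          have heq : (n : ℝ) = bigP D ^ (0.502 : ℝ) := le_antisymm (not_lt.mp hb) hlo
          have hTn : bigT D * (n : ℝ) < bigP D ^ (0.504 : ℝ) := by rw [heq]; exact hTP
          have hwin : (bigP D ^ (0.5 : ℝ) / bigT D < (n : ℝ) ∧ (n : ℝ) ≤ bigP D ^ (0.5 : ℝ)) ∨
              (bigP D ^ (0.502 : ℝ) / bigT D < (n : ℝ) ∧ (n : ℝ) ≤ bigP D ^ (0.502 : ℝ)) ∨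
              (bigP D ^ (0.504 : ℝ) / bigT D < (n : ℝ) ∧ (n : ℝ) < bigP D ^ (0.504 : ℝ)) := by
            right; left
            refine ⟨?_, le_of_eq heq⟩
            have : bigP D ^ (0.502 : ℝ) / bigT D < bigP D ^ (0.502 : ℝ) := div_lt_self hP2 hT1
            linarith
          have hv : ‖frakv1 c' χ j (n : ℝ)‖ ≤ |C₁| * (ell D ^ 7)⁻¹ :=
            ((h₁' n).2.2.2 hwin).trans (mul_le_mul_of_nonneg_right (le_abs_self _) (by positivity))
          have h1 : ‖mSum13 c' χ j n - 500 * deriv χ.LFunction 1 / Real.log (bigP D) *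
              (1 - betaJ c' D j * (Real.log (bigP D ^ (0.504 : ℝ) / n) : ℂ))‖ ≤
              |C₁| * (ell D ^ 7)⁻¹ + A := by
            rw [hMv]
            exact (norm_sub_le _ _).trans (add_le_add hv hm₁)
          have := Sj1321Mid.norm_sum_divisors_le c' χ j hn0 (mSum13 c' χ j n) _ _ _ he₂n0
            (by positivity) hlP1pos h1 hm₁ hg hL' hN (h2 hTn)
          refine this.trans ?_
          refine (per_n_scale' hρ2.symm hρ2_1 hρ0 (by positivity) (by positivity)
            hnpos.le hlP1pos).trans ?_
          have e : ((n : ℝ) / Nat.totient n) ^ 9 / n *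
              (((|C₁| * (ell D ^ 7)⁻¹ + A) * (e₂ + 146 * ell D ^ 3) + A * e₂) /
                Real.log (Skeleton.P1 D)) = Be * (((n : ℝ) / Nat.totient n) ^ 9 / n) := by
            rw [hBe]; ring
          rw [e]
          exact mul_le_mul_of_nonneg_right (le_add_of_nonneg_right hBp0) hw0
        · -- `T·n = P₁`: (10.4) × crude
          have hTn : bigT D * (n : ℝ) = bigP D ^ (0.504 : ℝ) := le_antisymm htn (not_lt.mp hb)
          have hlo' : bigP D ^ (0.502 : ℝ) < (n : ℝ) := by
            by_contra hcon
            have heq : (n : ℝ) = bigP D ^ (0.502 : ℝ) := le_antisymm (not_lt.mp hcon) hlo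
            rw [heq] at hTn
            exact (ne_of_lt hTP) hTn
          have hyT : (n : ℝ) ≤ bigP D ^ (0.504 : ℝ) / bigT D := by
            rw [le_div_iff₀ hT0, mul_comm]; exact hTn.le
          have h1' : ‖mSum13 c' χ j n - 500 * deriv χ.LFunction 1 / Real.log (bigP D) *
              (1 - betaJ c' D j * (Real.log (bigP D ^ (0.504 : ℝ) / n) : ℂ))‖ ≤
              |C₁| * (ell D ^ 7)⁻¹ := by
            rw [hMv]
            refine ((h₁' n).2.2.1 hlo' hyT).trans ?_
            have h157 : (ell D ^ 15)⁻¹ ≤ (ell D ^ 7)⁻¹ :=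
              inv_anti₀ (pow_pos hLpos 7) (pow_le_pow_right₀ hL1 (by norm_num))
            calc C₁ * (ell D ^ 15)⁻¹ ≤ |C₁| * (ell D ^ 15)⁻¹ :=
                  mul_le_mul_of_nonneg_right (le_abs_self _) (by positivity)
              _ ≤ |C₁| * (ell D ^ 7)⁻¹ := mul_le_mul_of_nonneg_left h157 (abs_nonneg _)
          have hM : ‖mSum13 c' χ j n‖ ≤ |C₁| * (ell D ^ 7)⁻¹ + A := by
            have hins := norm_le_insert' (mSum13 c' χ j n)
              (500 * deriv χ.LFunction 1 / Real.log (bigP D) *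
                (1 - betaJ c' D j * (Real.log (bigP D ^ (0.504 : ℝ) / n) : ℂ)))
            linarith only [hins, h1', hm₁]
          have := norm_sum_divisors_le_crude c' χ j hn0 (mSum13 c' χ j n) _ _ _ hBξ0
            (by positivity) hlP1pos hM hm₁ hg hL' hN (hS hTn.symm.le)
          refine this.trans ?_
          refine (mul_le_mul_of_nonneg_right h79 (div_nonneg (by positivity) hlP1pos.le)).trans ?_
          have e : ((n : ℝ) / Nat.totient n) ^ 9 / n *
              (((|C₁| * (ell D ^ 7)⁻¹ + A) * Bξ + 146 * A * ell D ^ 3) /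
                Real.log (Skeleton.P1 D)) = Bp * (((n : ℝ) / Nat.totient n) ^ 9 / n) := by
            rw [hBp]; ring
          rw [e]
          exact mul_le_mul_of_nonneg_right (le_add_of_nonneg_left hBe0) hw0
  -- **summation over the range**
  have hw0 : ∀ n : ℕ, 0 ≤ ((n : ℝ) / Nat.totient n) ^ 9 / n := fun n => by positivity
  -- weights of the three classes
  have hWg : ∑ n ∈ S, (if good n then ((n : ℝ) / Nat.totient n) ^ 9 / n else 0) ≤
      Real.exp 1024 * (2 + ell D ^ 9) := by
    rw [← Finset.sum_filter]
    refine le_trans (Finset.sum_le_sum_of_subset_of_nonneg ?_ fun n _ _ => hw0 n)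
      (weight_good_top_le9 hL3)
    intro n hn
    rw [Finset.mem_filter] at hn
    obtain ⟨-, hg1, hg2⟩ := hn
    rw [Finset.mem_Ioc]
    refine ⟨(Nat.floor_lt hP2.le).mpr hg1, Nat.le_floor ?_⟩
    rw [le_div_iff₀ hT0, mul_comm]; exact hg2.le
  have hWt : ∑ n ∈ S, (if ¬ good n ∧ tail n then ((n : ℝ) / Nat.totient n) ^ 9 / n else 0) ≤
      Real.exp 1024 * (3 + t) := by
    rw [← Finset.sum_filter, ← hlogT]
    refine le_trans (Finset.sum_le_sum_of_subset_of_nonneg ?_ fun n _ _ => hw0 n)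
      (weight_tail_top_le9 hL3)
    intro n hn
    rw [Finset.mem_filter, hSdef, Finset.mem_filter, Finset.mem_Ico] at hn
    obtain ⟨⟨⟨hn1, -⟩, hlo, hhi⟩, -, htn⟩ := hn
    rw [Finset.mem_Ioc]
    constructor
    · -- `⌈P₁/T⌉ − 1 < n` from `P₁/T < n`
      have h1 : bigP D ^ (0.504 : ℝ) / bigT D < (n : ℝ) := by
        rw [div_lt_iff₀ hT0, mul_comm]; exact htn
      have h2 : ⌈bigP D ^ (0.504 : ℝ) / bigT D⌉₊ ≤ n := Nat.ceil_le.mpr h1.le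
      omega
    · exact Nat.cast_le.mp ((hhi.le).trans (Nat.le_ceil _))
  have hWo : ∑ n ∈ S, (if ¬ good n ∧ ¬ tail n then ((n : ℝ) / Nat.totient n) ^ 9 / n else 0) ≤
      4 * Real.exp 1024 := by
    rw [← Finset.sum_filter]
    have hlo2 : (1 : ℝ) < bigP D ^ (0.502 : ℝ) :=
      Real.one_lt_rpow (one_lt_bigP₉ hLpos) (by norm_num)
    set k₁ : ℕ := ⌈bigP D ^ (0.502 : ℝ)⌉₊ with hk₁
    set k₂ : ℕ := ⌈bigP D ^ (0.504 : ℝ) / bigT D⌉₊ with hk₂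
    have hk₁2 : 2 ≤ k₁ := by
      have : 1 < k₁ := Nat.lt_ceil.mpr (by exact_mod_cast hlo2)
      omega
    have hy1 : (1 : ℝ) < bigP D ^ (0.504 : ℝ) / bigT D := by
      rw [lt_div_iff₀ hT0, one_mul]
      calc bigT D = bigT D * 1 := (mul_one _).symm
        _ < bigT D * bigP D ^ (0.502 : ℝ) := by gcongr
        _ < bigP D ^ (0.504 : ℝ) := hTP
    have hk₂2 : 2 ≤ k₂ := by
      have : 1 < k₂ := Nat.lt_ceil.mpr (by exact_mod_cast hy1)
      omega
    set A₁ := Finset.Ioc (k₁ - 1) k₁ with hA₁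
    set A₂ := Finset.Ioc (k₂ - 1) k₂ with hA₂
    have hsub : S.filter (fun n => ¬ good n ∧ ¬ tail n) ⊆ A₁ ∪ A₂ := by
      intro n hn
      rw [Finset.mem_filter, hSdef, Finset.mem_filter, Finset.mem_Ico] at hn
      obtain ⟨⟨⟨hn1, -⟩, hlo, hhi⟩, hng, hnt⟩ := hn
      rw [htail, not_lt] at hnt
      rw [hgood, not_and_or] at hng
      rw [Finset.mem_union]
      rcases hng with h | h
      · left
        have heq : (n : ℝ) = bigP D ^ (0.502 : ℝ) := le_antisymm (not_lt.mp h) hlo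
        have hkn : k₁ = n := by rw [hk₁, ← heq, Nat.ceil_natCast]
        rw [hA₁, Finset.mem_Ioc, hkn]
        omega
      · right
        have heq : bigT D * (n : ℝ) = bigP D ^ (0.504 : ℝ) := le_antisymm hnt (not_lt.mp h)
        have heq' : (n : ℝ) = bigP D ^ (0.504 : ℝ) / bigT D := by
          rw [eq_div_iff hT0.ne', mul_comm]; exact heq
        have hkn : k₂ = n := by rw [hk₂, ← heq', Nat.ceil_natCast]
        rw [hA₂, Finset.mem_Ioc, hkn]
        omega
    have hAB := Finset.sum_union_inter (s₁ := A₁) (s₂ := A₂)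
      (f := fun n : ℕ => ((n : ℝ) / Nat.totient n) ^ 9 / n)
    have hA1 := Sj1321Mid.weight_point_le9 hk₁2
    have hA2 := Sj1321Mid.weight_point_le9 hk₂2
    have hI : 0 ≤ ∑ n ∈ A₁ ∩ A₂, ((n : ℝ) / Nat.totient n) ^ 9 / n :=
      Finset.sum_nonneg fun n _ => hw0 n
    calc ∑ n ∈ S.filter (fun n => ¬ good n ∧ ¬ tail n), ((n : ℝ) / Nat.totient n) ^ 9 / n
        ≤ ∑ n ∈ A₁ ∪ A₂, ((n : ℝ) / Nat.totient n) ^ 9 / n :=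
          Finset.sum_le_sum_of_subset_of_nonneg hsub fun n _ _ => hw0 n
      _ ≤ ∑ n ∈ A₁, ((n : ℝ) / Nat.totient n) ^ 9 / n +
            ∑ n ∈ A₂, ((n : ℝ) / Nat.totient n) ^ 9 / n := by linarith
      _ ≤ 2 * Real.exp 1024 + 2 * Real.exp 1024 := add_le_add hA1 hA2
      _ = 4 * Real.exp 1024 := by ring
  -- assemble
  calc ‖∑ n ∈ S, ∑ r ∈ n.divisors, drWeight c' χ j (n / r) r *
          (mSum13 c' χ j n * nSum21 c' χ j (n / r) r -
            (500 * deriv χ.LFunction 1 / Real.log (bigP D) *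
                (1 - betaJ c' D j * (Real.log (bigP D ^ (0.504 : ℝ) / n) : ℂ))) *
              (deriv χ.LFunction 1 * PiW χ (n / r) r *
                frakgW c' D j 6 (Skeleton.P1 D / (n : ℝ)) / (Real.log (Skeleton.P1 D) : ℂ)))‖
      ≤ ∑ n ∈ S, ‖∑ r ∈ n.divisors, drWeight c' χ j (n / r) r *
          (mSum13 c' χ j n * nSum21 c' χ j (n / r) r -
            (500 * deriv χ.LFunction 1 / Real.log (bigP D) *
                (1 - betaJ c' D j * (Real.log (bigP D ^ (0.504 : ℝ) / n) : ℂ))) *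
              (deriv χ.LFunction 1 * PiW χ (n / r) r *
                frakgW c' D j 6 (Skeleton.P1 D / (n : ℝ)) / (Real.log (Skeleton.P1 D) : ℂ)))‖ :=
        norm_sum_le _ _
    _ ≤ ∑ n ∈ S, (Bg * (if good n then ((n : ℝ) / Nat.totient n) ^ 9 / n else 0) +
          Bt * (if ¬ good n ∧ tail n then ((n : ℝ) / Nat.totient n) ^ 9 / n else 0) +
          (Be + Bp) * (if ¬ good n ∧ ¬ tail n then ((n : ℝ) / Nat.totient n) ^ 9 / n else 0)) :=
        Finset.sum_le_sum key
    _ = Bg * ∑ n ∈ S, (if good n then ((n : ℝ) / Nat.totient n) ^ 9 / n else 0) +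
          Bt * ∑ n ∈ S, (if ¬ good n ∧ tail n then ((n : ℝ) / Nat.totient n) ^ 9 / n else 0) +
          (Be + Bp) * ∑ n ∈ S,
            (if ¬ good n ∧ ¬ tail n then ((n : ℝ) / Nat.totient n) ^ 9 / n else 0) := by
        rw [Finset.sum_add_distrib, Finset.sum_add_distrib, Finset.mul_sum, Finset.mul_sum,
          Finset.mul_sum]
    _ ≤ Bg * (Real.exp 1024 * (2 + ell D ^ 9)) + Bt * (Real.exp 1024 * (3 + t)) +
          (Be + Bp) * (4 * Real.exp 1024) := by
        gcongr
    _ = Real.exp 768 * (Bg * (Real.exp 256 * (2 + ell D ^ 9)) + Bt * (Real.exp 256 * (3 + t)) +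
          Be * (4 * Real.exp 256) + Bp * (4 * Real.exp 256)) := by
        have he : Real.exp 1024 = Real.exp 768 * Real.exp 256 := by
          rw [← Real.exp_add]; norm_num
        rw [he]; ring
    _ ≤ Real.exp 768 * (4 * Real.exp 256 * Kg / (s * ell D ^ 9) +
          Real.exp 256 * (64 * |C₁| * Cξp + 1168000) / (s * ell D ^ 9) +
          8 * Real.exp 256 * Ke / (s * ell D ^ 9) +
          Real.exp 256 * (64 * (|C₁| + 1000) * Cξp + 1168000) / (s * ell D ^ 9)) := by
        refine mul_le_mul_of_nonneg_left ?_ (Real.exp_pos _).le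
        have hBg' : Bg * (Real.exp 256 * (2 + ell D ^ 9)) ≤
            Kg * (ell D ^ 12)⁻¹ / (0.504 * ell D ^ 9) * (Real.exp 256 * (2 + ell D ^ 9)) := by
          have : Bg ≤ Kg * (ell D ^ 12)⁻¹ / (0.504 * ell D ^ 9) := by
            rw [hBg, hlP1]
            exact div_le_div_of_nonneg_right (Sj1321Mid.coeff_good_le hL1 C₁ C₂) (by positivity)
          exact mul_le_mul_of_nonneg_right this (by positivity)
        have hBe' : Be * (4 * Real.exp 256) ≤
            Ke * (ell D ^ 3)⁻¹ / (0.504 * ell D ^ 9) * (4 * Real.exp 256) := by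
          have : Be ≤ Ke * (ell D ^ 3)⁻¹ / (0.504 * ell D ^ 9) := by
            rw [hBe, hlP1]
            exact div_le_div_of_nonneg_right (Sj1321Mid.coeff_edge_le hL1 C₁ C₂) (by positivity)
          exact mul_le_mul_of_nonneg_right this (by positivity)
        have hT1 := term_good_le hL3 hKg0 hs1 hsL
        have hT2 := term_edge_le hL3 hKe0 hs1 hsL
        have hT3 := term_point_le (C₁ := C₁) hL3 hs1 hsL hs2 ht1 ht4 hCξ0
        have hT4 := term_tail_le (C₁ := C₁) hL3 hs1 hsL hs2 ht3 htL2 ht5 hCξ0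
        rw [hBp, hBt, hlP1, hBξ, hAdef]
        linarith [hBg'.trans hT1, hBe'.trans hT2, hT3, hT4]
    _ = Real.exp 256 * (Real.exp 768 * K) / (s * ell D ^ 9) := by
        rw [hK]
        field_simp
        ring
    _ ≤ ε * (π / ell D ^ 9) := threshold_le hLpos hs0 hε hth
    _ = ε * alpha D := by rw [hα]

/-- **`Z22:§10.u044` (first line) from the relative Lemma 8.4 alone**, for `c′ ≥ 0` (Lemma 10.1 is
the tree theorem `Skeleton.lemma101_holds`). [cite: Zhang2022LandauSiegel, §10 p. 58] -/
theorem eq1044a_of_lemma84Rel {c' : ℝ} (hc' : 0 ≤ c') (h84 : Lemma84Rel c') : Eq1044a c' :=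
  eq1044a_of_rel c' (lemma101_holds hc') h84

end Literature.NumberTheory.LFunctions.Zhang2022.Sj1321Top
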